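import Mathlib
import HarnessLib

/-!
# Curtiss' theorem: convergence of moment generating functions on a neighbourhood of 0 implies convergence of all moments

Topic: probability / moments, several real variables. Let `ν₀, ν₁, …` be measures on
`ℝᵐ = Fin m → ℝ` whose moment generating functions `M_k(s) = ∫ exp (∑ᵢ sᵢ xᵢ) dν_k(x)` are finite
on the open cube `{s | ∀ i, |sᵢ| < δ}` and converge there pointwise, as `k → ∞`, to finite limits.
Then every mixed moment converges: for every multi-index `p : Fin m → ℕ` the sequence
`∫ ∏ᵢ xᵢ ^ pᵢ dν_k` has a finite limit (`tendsto_integral_prod_pow_of_tendsto_mgf`). This is the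
moment half of Curtiss' continuity theorem for moment generating functions (J. H. Curtiss, *A note
on the theory of moment generating functions*, Ann. Math. Statist. **13** (1942) 430–433, Thm. 3),
in the multivariate form used for free energies with several real sources. No normalisation of the
`ν_k` is assumed (finiteness of `M_k(0)` is part of the hypothesis); `m = 0` is the trivial case.

## Proof (elementary; no weak convergence, no analyticity)

With `c = δ/2`, the weight `G(x) = ∏ᵢ (e^{c xᵢ} + e^{-c xᵢ})` is the sum of the `2ᵐ` kernels
`exp (∑ᵢ ±c xᵢ)` (`prod_exp_add_exp_neg_eq_sum`), whose integrals converge, hence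
`sup_k ∫ G dν_k < ∞`. For a step `h > 0` replace `xᵢ` by the difference quotient `(e^{h xᵢ} - 1)/h`:
from `|eᵘ - 1| ≤ |u| e^{|u|}`, `|eᵘ - 1 - u| ≤ u² e^{|u|}` and `|y|ⁿ ≤ n! ρ⁻ⁿ e^{ρ|y|}` one gets,
for `n h ≤ c/2`, `|yⁿ|, |((e^{hy} - 1)/h)ⁿ| ≤ K (e^{cy} + e^{-cy})` and
`|((e^{hy} - 1)/h)ⁿ - yⁿ| ≤ h K (e^{cy} + e^{-cy})` (`exists_const_pow_approx`); telescoping over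
the coordinates (`abs_prod_sub_prod_le_card_mul`) the moments are approximated by the integrals of
`∏ᵢ ((e^{h xᵢ} - 1)/h)^{pᵢ}` with an error `≤ m h (∏ Kᵢ) sup_k ∫ G dν_k = O(h)` UNIFORM in `k`. For
fixed `h` that product is (binomial theorem, `exists_prod_pow_eq_sum_exp`) a finite combination of
kernels `exp (∑ᵢ (βᵢ h) xᵢ)`, `βᵢ ≤ pᵢ`, inside the cube, so its integrals converge; a sequence
uniformly `ε`-close to convergent sequences for every `ε > 0` is Cauchy.

## Mathlib

We USE `Real.add_one_le_exp`, `Real.exp_abs_le`, `Real.pow_div_factorial_le_exp`,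
`abs_pow_sub_pow_le`, `Finset.prod_univ_sum`, `sub_pow`, `MeasureTheory.integral_finsetSum`,
`Filter.Tendsto.bddAbove_range`, `Metric.cauchySeq_iff'`. Mathlib has the analyticity of the
one-dimensional `ProbabilityTheory.mgf` (`Mathlib/Probability/Moments/MGFAnalytic.lean`) but no
continuity theorem for MGFs (searched `mgf.*tendsto`, `Curtiss`). No definitions are introduced.
-/

open Filter Real Finset _root_.MeasureTheory
open scoped Topology Nat

namespace Literature.Probability.Moments

/-! ## Elementary one-variable estimates -/

/-- `|eᵘ - 1| ≤ e^{|u|} |u|` for every real `u` (from `1 + u ≤ eᵘ`). [folklore] -/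
theorem abs_exp_sub_one_le_exp_abs_mul_abs (u : ℝ) : |exp u - 1| ≤ exp |u| * |u| := by
  rcases le_total 0 u with hu | hu
  · have h1 : 1 - u ≤ exp (-u) := by linarith [add_one_le_exp (-u)]
    have h3 : exp u * (1 - u) ≤ 1 := by
      calc exp u * (1 - u) ≤ exp u * exp (-u) := mul_le_mul_of_nonneg_left h1 (exp_pos u).le
        _ = 1 := by rw [← exp_add, add_neg_cancel, exp_zero]
    rw [abs_of_nonneg hu, abs_of_nonneg (by linarith [add_one_le_exp u])]
    linarith
  · have h1 : u + 1 ≤ exp u := add_one_le_exp u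
    have h2 : 1 ≤ exp (-u) := one_le_exp (by linarith)
    rw [abs_of_nonpos hu, abs_of_nonpos (by linarith [exp_le_one_iff.mpr hu])]
    nlinarith [mul_nonneg (neg_nonneg.mpr hu) (sub_nonneg.mpr h2)]

/-- `|eᵘ - 1 - u| ≤ u² e^{|u|}` for every real `u`
(from `0 ≤ eᵘ - 1 - u ≤ u (eᵘ - 1)`, i.e. `eᵘ (1 - u) ≤ 1`). [folklore] -/
theorem abs_exp_sub_one_sub_self_le_sq_mul_exp_abs (u : ℝ) :
    |exp u - 1 - u| ≤ u ^ 2 * exp |u| := by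
  have h0 : 0 ≤ exp u - 1 - u := by linarith [add_one_le_exp u]
  have h1 : exp u * (1 - u) ≤ 1 := by
    calc exp u * (1 - u) ≤ exp u * exp (-u) :=
          mul_le_mul_of_nonneg_left (by linarith [add_one_le_exp (-u)]) (exp_pos u).le
      _ = 1 := by rw [← exp_add, add_neg_cancel, exp_zero]
  rw [abs_of_nonneg h0]
  calc exp u - 1 - u ≤ u * (exp u - 1) := by linarith
    _ ≤ |u| * |exp u - 1| := (le_abs_self _).trans_eq (abs_mul _ _)
    _ ≤ |u| * (exp |u| * |u|) :=
        mul_le_mul_of_nonneg_left (abs_exp_sub_one_le_exp_abs_mul_abs u) (abs_nonneg u)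
    _ = u ^ 2 * exp |u| := by rw [mul_left_comm, abs_mul_abs_self, sq, mul_comm]

/-- **Difference quotients of exponentials approximate powers, with two-sided exponential
control.** For `n : ℕ` and `c > 0` there is `K ≥ 0` with, for all real `y`,
`|yⁿ| ≤ K (e^{cy} + e^{-cy})`, and for every step `h > 0` with `n h ≤ c/2`,
`|((e^{hy} - 1)/h)ⁿ| ≤ K (e^{cy} + e^{-cy})` and `|((e^{hy} - 1)/h)ⁿ - yⁿ| ≤ h K (e^{cy} + e^{-cy})`
(`K = n!/(c/2)ⁿ + n (n+1)!/(c/2)ⁿ⁺¹`, via `|y|ʲ ≤ j! ρ⁻ʲ e^{ρ|y|}` and `abs_pow_sub_pow_le`).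
[folklore] -/
theorem exists_const_pow_approx (n : ℕ) {c : ℝ} (hc : 0 < c) :
    ∃ K : ℝ, 0 ≤ K ∧ ∀ y : ℝ, |y ^ n| ≤ K * (exp (c * y) + exp (-(c * y))) ∧
      ∀ h : ℝ, 0 < h → n * h ≤ c / 2 →
        |((exp (h * y) - 1) / h) ^ n| ≤ K * (exp (c * y) + exp (-(c * y))) ∧
        |((exp (h * y) - 1) / h) ^ n - y ^ n| ≤ h * (K * (exp (c * y) + exp (-(c * y)))) := by
  have hρ : 0 < c / 2 := by positivity
  set K₁ : ℝ := n ! / (c / 2) ^ n with hK₁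
  set K₂ : ℝ := (n + 1)! / (c / 2) ^ (n + 1) with hK₂
  obtain ⟨hK₁0, hK₂0⟩ : 0 ≤ K₁ ∧ 0 ≤ K₂ := ⟨by positivity, by positivity⟩
  refine ⟨K₁ + n * K₂, by positivity, fun y => ?_⟩
  have hE : exp (c * |y|) ≤ exp (c * y) + exp (-(c * y)) := by
    simpa only [abs_mul, abs_of_pos hc] using exp_abs_le (c * y)
  have hEpos : 0 < exp (c * y) + exp (-(c * y)) := by positivity
  have hP : ∀ j : ℕ, |y| ^ j ≤ j ! / (c / 2) ^ j * exp (c / 2 * |y|) := fun j => by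
    have h := pow_div_factorial_le_exp _ (mul_nonneg hρ.le (abs_nonneg y)) j
    rw [div_le_iff₀ (by positivity : (0:ℝ) < j !)] at h
    rw [div_mul_eq_mul_div, le_div_iff₀ (by positivity : (0:ℝ) < (c / 2) ^ j)]
    calc |y| ^ j * (c / 2) ^ j = (c / 2 * |y|) ^ j := by ring
      _ ≤ exp (c / 2 * |y|) * j ! := h
      _ = j ! * exp (c / 2 * |y|) := mul_comm _ _
  have hhalf : exp (c / 2 * |y|) * exp (c / 2 * |y|) = exp (c * |y|) := by rw [← exp_add]; ring_nf
  have hhalf_le : exp (c / 2 * |y|) ≤ exp (c * |y|) := exp_le_exp.2 (by nlinarith [abs_nonneg y])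
  have hK_le : K₁ * exp (c * |y|) ≤ (K₁ + n * K₂) * (exp (c * y) + exp (-(c * y))) := by
    apply mul_le_mul _ hE (exp_pos _).le (by positivity)
    linarith [mul_nonneg (Nat.cast_nonneg n) hK₂0]
  refine ⟨?_, fun h hh hnh => ?_⟩
  · calc |y ^ n| = |y| ^ n := abs_pow y n
      _ ≤ K₁ * exp (c / 2 * |y|) := hP n
      _ ≤ K₁ * exp (c * |y|) := mul_le_mul_of_nonneg_left hhalf_le hK₁0
      _ ≤ (K₁ + n * K₂) * (exp (c * y) + exp (-(c * y))) := hK_le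
  · set a := (exp (h * y) - 1) / h with ha
    set R := |y| * exp (h * |y|) with hR
    have hR0 : 0 ≤ R := by positivity
    have haR : |a| ≤ R := by
      rw [ha, abs_div, abs_of_pos hh, div_le_iff₀ hh]
      calc |exp (h * y) - 1| ≤ exp |h * y| * |h * y| := abs_exp_sub_one_le_exp_abs_mul_abs _
        _ = R * h := by rw [abs_mul, abs_of_pos hh, hR]; ring
    have hyR : |y| ≤ R := le_mul_of_one_le_right (abs_nonneg y) (one_le_exp (by positivity))
    have hay : |a - y| ≤ h * |y| * R := by
      have : a - y = (exp (h * y) - 1 - h * y) / h := by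
        rw [ha]; field_simp
      rw [this, abs_div, abs_of_pos hh, div_le_iff₀ hh]
      calc |exp (h * y) - 1 - h * y| ≤ (h * y) ^ 2 * exp |h * y| :=
            abs_exp_sub_one_sub_self_le_sq_mul_exp_abs _
        _ = h * |y| * R * h := by
            rw [abs_mul, abs_of_pos hh, hR, ← sq_abs (h * y), abs_mul, abs_of_pos hh]; ring
    have hexpn : exp (h * |y|) ^ n ≤ exp (c / 2 * |y|) := by
      rw [← exp_nat_mul]
      exact exp_le_exp.mpr (by nlinarith [abs_nonneg y])
    have hRn : R ^ n ≤ K₁ * exp (c * |y|) := by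
      calc R ^ n = |y| ^ n * exp (h * |y|) ^ n := mul_pow _ _ _
        _ ≤ (K₁ * exp (c / 2 * |y|)) * exp (c / 2 * |y|) :=
            mul_le_mul (hP n) hexpn (by positivity) (by positivity)
        _ = K₁ * exp (c * |y|) := by rw [mul_assoc, hhalf]
    have hRn1 : |y| * R ^ n ≤ K₂ * exp (c * |y|) := by
      calc |y| * R ^ n = |y| ^ (n + 1) * exp (h * |y|) ^ n := by rw [hR, mul_pow]; ring
        _ ≤ (K₂ * exp (c / 2 * |y|)) * exp (c / 2 * |y|) :=
            mul_le_mul (hP (n + 1)) hexpn (by positivity) (by positivity)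
        _ = K₂ * exp (c * |y|) := by rw [mul_assoc, hhalf]
    constructor
    · calc |a ^ n| = |a| ^ n := abs_pow a n
        _ ≤ R ^ n := pow_le_pow_left₀ (abs_nonneg a) haR n
        _ ≤ K₁ * exp (c * |y|) := hRn
        _ ≤ (K₁ + n * K₂) * (exp (c * y) + exp (-(c * y))) := hK_le
    · calc |a ^ n - y ^ n| ≤ |a - y| * n * max |a| |y| ^ (n - 1) := abs_pow_sub_pow_le _ _ _
        _ ≤ (h * |y| * R) * n * R ^ (n - 1) :=
            mul_le_mul (mul_le_mul_of_nonneg_right hay (Nat.cast_nonneg n))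
              (pow_le_pow_left₀ ((abs_nonneg a).trans (le_max_left _ _)) (max_le haR hyR) _)
              (by positivity) (by positivity)
        _ = h * n * (|y| * R ^ n) := by
            rcases Nat.eq_zero_or_pos n with rfl | hn
            · simp
            · obtain ⟨k, rfl⟩ := Nat.exists_eq_add_one_of_ne_zero hn.ne'
              rw [Nat.add_sub_cancel, pow_succ]; push_cast; ring
        _ ≤ h * n * (K₂ * exp (c * |y|)) := mul_le_mul_of_nonneg_left hRn1 (by positivity)
        _ = h * (n * (K₂ * exp (c * |y|))) := by ring
        _ ≤ h * ((K₁ + n * K₂) * (exp (c * y) + exp (-(c * y)))) := by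
            refine mul_le_mul_of_nonneg_left ?_ hh.le
            nlinarith [mul_le_mul_of_nonneg_left hE hK₂0, mul_nonneg hK₁0 hEpos.le,
              (Nat.cast_nonneg n : (0 : ℝ) ≤ n)]

/-- **Telescoping estimate for a difference of products**: if `|Aᵢ|, |Bᵢ| ≤ Mᵢ` and
`|Aᵢ - Bᵢ| ≤ h Mᵢ` on `s`, then `|∏ₛ A - ∏ₛ B| ≤ #s · h · ∏ₛ M`. [folklore] -/
theorem abs_prod_sub_prod_le_card_mul {ι : Type*} (s : Finset ι) (A B M : ι → ℝ) {h : ℝ}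
    (hh : 0 ≤ h) (hA : ∀ i ∈ s, |A i| ≤ M i) (hB : ∀ i ∈ s, |B i| ≤ M i)
    (hAB : ∀ i ∈ s, |A i - B i| ≤ h * M i) :
    |∏ i ∈ s, A i - ∏ i ∈ s, B i| ≤ s.card * h * ∏ i ∈ s, M i := by
  classical
  induction s using Finset.induction_on with
  | empty => simp
  | insert a s has ih =>
    rw [prod_insert has, prod_insert has, prod_insert has, card_insert_of_notMem has]
    have ih' := ih (fun i hi => hA i (mem_insert_of_mem hi))
      (fun i hi => hB i (mem_insert_of_mem hi)) (fun i hi => hAB i (mem_insert_of_mem hi))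
    have hPB : |∏ i ∈ s, B i| ≤ ∏ i ∈ s, M i := by
      rw [abs_prod]
      exact prod_le_prod (fun i _ => abs_nonneg _) (fun i hi => hB i (mem_insert_of_mem hi))
    have hMa : 0 ≤ M a := (abs_nonneg _).trans (hA a (mem_insert_self a s))
    calc |A a * ∏ i ∈ s, A i - B a * ∏ i ∈ s, B i|
        = |A a * (∏ i ∈ s, A i - ∏ i ∈ s, B i) + (A a - B a) * ∏ i ∈ s, B i| := by
          congr 1; ring
      _ ≤ |A a| * |∏ i ∈ s, A i - ∏ i ∈ s, B i| + |A a - B a| * |∏ i ∈ s, B i| := by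
          rw [← abs_mul, ← abs_mul]; exact abs_add_le _ _
      _ ≤ M a * (s.card * h * ∏ i ∈ s, M i) + (h * M a) * ∏ i ∈ s, M i :=
          add_le_add (mul_le_mul (hA a (mem_insert_self a s)) ih' (abs_nonneg _) hMa)
            (mul_le_mul (hAB a (mem_insert_self a s)) hPB (abs_nonneg _) (mul_nonneg hh hMa))
      _ = ((s.card + 1 : ℕ) : ℝ) * h * (M a * ∏ i ∈ s, M i) := by push_cast; ring

/-! ## Two finite expansions into exponentials of linear forms -/

/-- `∏ᵢ (e^{c xᵢ} + e^{-c xᵢ}) = ∑_{ε ∈ {±}ᵐ} exp (∑ᵢ (±c) xᵢ)`: the two-sided exponential weight on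
`ℝᵐ` is the sum of the `2ᵐ` moment-generating kernels at the vertices of the cube of radius `c`.
[folklore] -/
theorem prod_exp_add_exp_neg_eq_sum {m : ℕ} (c : ℝ) (x : Fin m → ℝ) :
    ∏ i, (exp (c * x i) + exp (-(c * x i))) =
      ∑ ε : Fin m → Bool, exp (∑ i, (if ε i then c else -c) * x i) := by
  have h1 : ∀ i, exp (c * x i) + exp (-(c * x i)) =
      ∑ b : Bool, exp ((if b then c else -c) * x i) := by
    intro i; rw [Fintype.sum_bool]; simp [neg_mul]
  simp_rw [h1]
  rw [Fintype.prod_sum]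
  exact Fintype.sum_congr _ _ fun ε => (exp_sum _ _).symm

/-- **Binomial expansion of the difference-quotient product**: for a multi-index `p` and a step
`h`, `∏ᵢ ((e^{h xᵢ} - 1)/h)^{pᵢ}` is a fixed (in `x`) finite linear combination of the exponentials
`exp (∑ᵢ (βᵢ h) xᵢ)` over the multi-indices `β ≤ p`. [folklore] -/
theorem exists_prod_pow_eq_sum_exp {m : ℕ} (p : Fin m → ℕ) (h : ℝ) :
    ∃ coef : (Fin m → ℕ) → ℝ, ∀ x : Fin m → ℝ,
      ∏ i, ((exp (h * x i) - 1) / h) ^ p i =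
        ∑ β ∈ Fintype.piFinset (fun i => range (p i + 1)),
          coef β * exp (∑ i, (β i * h) * x i) := by
  refine ⟨fun β => ∏ i, ((-1 : ℝ) ^ (β i + p i) * (p i).choose (β i) / h ^ p i), fun x => ?_⟩
  have h1 : ∀ i, ((exp (h * x i) - 1) / h) ^ p i =
      ∑ j ∈ range (p i + 1), exp ((j * h) * x i) *
        ((-1 : ℝ) ^ (j + p i) * (p i).choose j / h ^ p i) := by
    intro i
    rw [div_pow, sub_pow, sum_div]
    refine sum_congr rfl fun j _ => ?_
    rw [one_pow, mul_one, ← exp_nat_mul, ← mul_assoc]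
    ring
  simp_rw [h1]
  rw [prod_univ_sum]
  refine sum_congr rfl fun β _ => ?_
  rw [prod_mul_distrib, ← exp_sum, mul_comm]

/-- A finite sum of convergent real sequences converges (existential form). [folklore] -/
theorem exists_tendsto_finsetSum {ι : Type*} (s : Finset ι) {u : ι → ℕ → ℝ}
    (hu : ∀ i ∈ s, ∃ L : ℝ, Tendsto (u i) atTop (𝓝 L)) :
    ∃ L : ℝ, Tendsto (fun k => ∑ i ∈ s, u i k) atTop (𝓝 L) :=
  ⟨∑ i ∈ s, limUnder atTop (u i), tendsto_finsetSum s fun i hi => tendsto_nhds_limUnder (hu i hi)⟩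

/-- **Approximation principle** (Cauchy criterion / Moore–Osgood): a real sequence which is, for
every `ε > 0`, uniformly `ε`-close to some convergent sequence, converges. [folklore] -/
theorem exists_tendsto_of_forall_approx_tendsto {u : ℕ → ℝ}
    (hu : ∀ ε : ℝ, 0 < ε → ∃ v : ℕ → ℝ,
      (∃ L : ℝ, Tendsto v atTop (𝓝 L)) ∧ ∀ k, |u k - v k| ≤ ε) :
    ∃ L : ℝ, Tendsto u atTop (𝓝 L) := by
  refine cauchySeq_tendsto_of_complete (Metric.cauchySeq_iff'.2 fun ε hε => ?_)
  obtain ⟨v, ⟨L, hL⟩, hv⟩ := hu (ε / 3) (by positivity)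
  obtain ⟨N, hN⟩ := Metric.cauchySeq_iff'.1 hL.cauchySeq (ε / 3) (by positivity)
  refine ⟨N, fun n hn => ?_⟩
  have h1 := hv n; have h2 := hv N; have h3 := hN n hn
  rw [Real.dist_eq] at h3 ⊢
  calc |u n - u N| ≤ |u n - v n| + |v n - u N| := abs_sub_le _ _ _
    _ ≤ |u n - v n| + (|v n - v N| + |v N - u N|) := by
        gcongr; exact abs_sub_le _ _ _
    _ < ε := by rw [abs_sub_comm (v N) (u N)]; linarith

/-- Choice of a small positive step: for `ε, h₀ > 0` and any real `Θ` there is `0 < h ≤ h₀` with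
`h Θ ≤ ε`. [folklore] -/
theorem exists_pos_le_mul_le (Θ : ℝ) {ε h₀ : ℝ} (hε : 0 < ε) (hh₀ : 0 < h₀) :
    ∃ h : ℝ, 0 < h ∧ h ≤ h₀ ∧ h * Θ ≤ ε := by
  refine ⟨min h₀ (ε / (|Θ| + 1)), lt_min hh₀ (by positivity), min_le_left _ _, ?_⟩
  calc min h₀ (ε / (|Θ| + 1)) * Θ ≤ min h₀ (ε / (|Θ| + 1)) * (|Θ| + 1) :=
        mul_le_mul_of_nonneg_left (by linarith [le_abs_self Θ]) (le_min hh₀.le (by positivity))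
    _ ≤ ε / (|Θ| + 1) * (|Θ| + 1) :=
        mul_le_mul_of_nonneg_right (min_le_right _ _) (by positivity)
    _ = ε := div_mul_cancel₀ _ (by positivity)

/-! ## Curtiss' theorem -/

/-- **Curtiss' theorem, multivariate moment form** (Curtiss 1942, Thm. 3). Let `ν_k` be measures on
`ℝᵐ = Fin m → ℝ` and `δ > 0`. Suppose that for every `s` in the open cube `{∀ i, |sᵢ| < δ}` the
kernels `x ↦ exp (∑ᵢ sᵢ xᵢ)` are `ν_k`-integrable for all `k` and the moment generating functions
`∫ exp (∑ᵢ sᵢ xᵢ) dν_k` converge to a finite limit as `k → ∞`. Then for every multi-index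
`p : Fin m → ℕ` the mixed moments `∫ ∏ᵢ xᵢ ^ pᵢ dν_k` converge to a finite limit.
(Uniform two-sided exponential moment bounds from the convergence at the `2ᵐ` vertices `(±δ/2)`;
`O(h)`-approximation of the monomial by products of difference quotients `((e^{h xᵢ} - 1)/h)^{pᵢ}`,
uniformly in `k`; the latter are finite combinations of the kernels at cube points; Cauchy
criterion.) [cite: Curtiss1942, Thm 3] -/
theorem tendsto_integral_prod_pow_of_tendsto_mgf (m : ℕ) (ν : ℕ → Measure (Fin m → ℝ))
    (δ : ℝ) (hδ : 0 < δ)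
    (hmgf : ∀ s : Fin m → ℝ, (∀ i, |s i| < δ) →
      (∀ k, Integrable (fun x => exp (∑ i, s i * x i)) (ν k)) ∧
        ∃ L : ℝ, Tendsto (fun k => ∫ x, exp (∑ i, s i * x i) ∂(ν k)) atTop (𝓝 L))
    (p : Fin m → ℕ) :
    ∃ c : ℝ, Tendsto (fun k => ∫ x, ∏ i, x i ^ p i ∂(ν k)) atTop (𝓝 c) := by
  -- (0) pointwise convergence gives bounds uniform in `k`
  have hbdd : ∀ s : Fin m → ℝ, (∀ i, |s i| < δ) →
      ∃ B : ℝ, ∀ k, ∫ x, exp (∑ i, s i * x i) ∂(ν k) ≤ B := by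
    intro s hs
    obtain ⟨B, hB⟩ := (hmgf s hs).2.choose_spec.bddAbove_range
    exact ⟨B, fun k => hB ⟨k, rfl⟩⟩
  -- (1) a radius `c < δ` and the dominating function `∏ i, (e^{c x i} + e^{-c x i})`
  obtain ⟨c, hc, hcδ⟩ : ∃ c : ℝ, 0 < c ∧ c < δ := ⟨δ / 2, by positivity, by linarith⟩
  have hsv : ∀ (ε : Fin m → Bool) (i : Fin m), |(if ε i then c else -c)| < δ := by
    intro ε i; split_ifs <;> simp [abs_of_pos hc, hcδ]
  have hGint : ∀ k, Integrable
      (fun x : Fin m → ℝ => ∏ i, (exp (c * x i) + exp (-(c * x i)))) (ν k) := by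
    intro k
    simp_rw [prod_exp_add_exp_neg_eq_sum]
    exact integrable_finsetSum _ fun ε _ => (hmgf _ (hsv ε)).1 k
  obtain ⟨BG, hBG⟩ : ∃ BG : ℝ, ∀ k,
      ∫ x, ∏ i, (exp (c * x i) + exp (-(c * x i))) ∂(ν k) ≤ BG := by
    choose B hB using fun ε : Fin m → Bool => hbdd _ (hsv ε)
    refine ⟨∑ ε, B ε, fun k => ?_⟩
    simp_rw [prod_exp_add_exp_neg_eq_sum]
    rw [integral_finsetSum _ fun ε _ => (hmgf _ (hsv ε)).1 k]
    exact sum_le_sum fun ε _ => hB ε k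
  -- (2) per-coordinate constants and the admissible step sizes `h ≤ h₀`
  choose K hK0 hK using fun i : Fin m => exists_const_pow_approx (p i) hc
  have hKp : 0 ≤ ∏ i, K i := prod_nonneg fun i _ => hK0 i
  obtain ⟨h₀, hh₀, hh₀p⟩ : ∃ h₀ : ℝ, 0 < h₀ ∧
      ∀ i, ∀ h, 0 < h → h ≤ h₀ → (p i : ℝ) * h ≤ c / 2 := by
    refine ⟨c / 2 / ((∑ j, p j : ℕ) + 1), by positivity, fun i h hh hle => ?_⟩
    have hpi : (p i : ℝ) ≤ (∑ j, p j : ℕ) := by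
      exact_mod_cast single_le_sum (fun j _ => Nat.zero_le (p j)) (mem_univ i)
    calc (p i : ℝ) * h ≤ (∑ j, p j : ℕ) * (c / 2 / ((∑ j, p j : ℕ) + 1)) :=
          mul_le_mul hpi hle hh.le (by positivity)
      _ ≤ c / 2 := by
          rw [mul_div_assoc', div_le_iff₀ (by positivity)]
          nlinarith
  -- (3) pointwise bounds: domination and the `O(h)` error, uniformly in `x`
  have hF_le : ∀ x : Fin m → ℝ,
      |∏ i, x i ^ p i| ≤ (∏ i, K i) * ∏ i, (exp (c * x i) + exp (-(c * x i))) := by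
    intro x
    rw [abs_prod, ← prod_mul_distrib]
    exact prod_le_prod (fun i _ => abs_nonneg _) fun i _ => (hK i (x i)).1
  have hP_le : ∀ h, 0 < h → h ≤ h₀ → ∀ x : Fin m → ℝ,
      |∏ i, ((exp (h * x i) - 1) / h) ^ p i|
        ≤ (∏ i, K i) * ∏ i, (exp (c * x i) + exp (-(c * x i))) := by
    intro h hh hle x
    rw [abs_prod, ← prod_mul_distrib]
    exact prod_le_prod (fun i _ => abs_nonneg _)
      fun i _ => ((hK i (x i)).2 h hh (hh₀p i h hh hle)).1
  have hPF_le : ∀ h, 0 < h → h ≤ h₀ → ∀ x : Fin m → ℝ,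
      |∏ i, ((exp (h * x i) - 1) / h) ^ p i - ∏ i, x i ^ p i|
        ≤ (m * h * ∏ i, K i) * ∏ i, (exp (c * x i) + exp (-(c * x i))) := by
    intro h hh hle x
    have := abs_prod_sub_prod_le_card_mul univ (fun i => ((exp (h * x i) - 1) / h) ^ p i)
      (fun i => x i ^ p i) (fun i => K i * (exp (c * x i) + exp (-(c * x i)))) hh.le
      (fun i _ => ((hK i (x i)).2 h hh (hh₀p i h hh hle)).1) (fun i _ => (hK i (x i)).1)
      (fun i _ => ((hK i (x i)).2 h hh (hh₀p i h hh hle)).2)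
    rwa [card_univ, Fintype.card_fin, prod_mul_distrib, ← mul_assoc] at this
  -- (4) integrability of the monomial and of its difference-quotient approximants
  have hF_int : ∀ k, Integrable (fun x : Fin m → ℝ => ∏ i, x i ^ p i) (ν k) := fun k =>
    ((hGint k).const_mul (∏ i, K i)).mono'
      (Continuous.aestronglyMeasurable (by fun_prop))
      (ae_of_all _ fun x => by rw [Real.norm_eq_abs]; exact hF_le x)
  have hP_int : ∀ h, 0 < h → h ≤ h₀ → ∀ k,
      Integrable (fun x : Fin m → ℝ => ∏ i, ((exp (h * x i) - 1) / h) ^ p i) (ν k) :=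
    fun h hh hle k =>
    ((hGint k).const_mul (∏ i, K i)).mono'
      (Continuous.aestronglyMeasurable (by fun_prop))
      (ae_of_all _ fun x => by rw [Real.norm_eq_abs]; exact hP_le h hh hle x)
  -- (5) for a fixed step the approximant is a finite combination of MGF values, so converges
  have hP_conv : ∀ h, 0 < h → h ≤ h₀ →
      ∃ L : ℝ, Tendsto (fun k => ∫ x, ∏ i, ((exp (h * x i) - 1) / h) ^ p i ∂(ν k))
        atTop (𝓝 L) := by
    intro h hh hle
    obtain ⟨coef, hcoef⟩ := exists_prod_pow_eq_sum_exp p h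
    have hsβ : ∀ β ∈ Fintype.piFinset (fun i => range (p i + 1)), ∀ i,
        |(β i : ℝ) * h| < δ := by
      intro β hβ i
      have hβi : β i ≤ p i :=
        Nat.lt_succ_iff.mp (mem_range.mp (Fintype.mem_piFinset.mp hβ i))
      rw [abs_of_nonneg (by positivity)]
      calc (β i : ℝ) * h ≤ p i * h := by gcongr
        _ ≤ c / 2 := hh₀p i h hh hle
        _ < δ := by linarith
    simp_rw [hcoef]
    have hI : ∀ k, ∫ x, ∑ β ∈ Fintype.piFinset (fun i => range (p i + 1)),
          coef β * exp (∑ i, (β i * h) * x i) ∂(ν k)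
        = ∑ β ∈ Fintype.piFinset (fun i => range (p i + 1)),
            coef β * ∫ x, exp (∑ i, (β i * h) * x i) ∂(ν k) := by
      intro k
      rw [integral_finsetSum _ fun β hβ => ((hmgf _ (hsβ β hβ)).1 k).const_mul (coef β)]
      simp_rw [integral_const_mul]
    simp_rw [hI]
    refine exists_tendsto_finsetSum _ fun β hβ => ?_
    obtain ⟨L, hL⟩ := (hmgf _ (hsβ β hβ)).2
    exact ⟨coef β * L, hL.const_mul _⟩
  -- (6) uniform `O(h)` approximation + convergence of the approximants ⇒ convergence
  refine exists_tendsto_of_forall_approx_tendsto fun ε hε => ?_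
  obtain ⟨h, hh, hle, hsmall⟩ :=
    exists_pos_le_mul_le ((m * ∏ i, K i) * BG) hε hh₀
  refine ⟨fun k => ∫ x, ∏ i, ((exp (h * x i) - 1) / h) ^ p i ∂(ν k), hP_conv h hh hle,
    fun k => ?_⟩
  rw [abs_sub_comm, ← integral_sub (hP_int h hh hle k) (hF_int k)]
  calc |∫ x, (∏ i, ((exp (h * x i) - 1) / h) ^ p i - ∏ i, x i ^ p i) ∂(ν k)|
      ≤ ∫ x, (m * h * ∏ i, K i) * ∏ i, (exp (c * x i) + exp (-(c * x i))) ∂(ν k) := by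
        have := norm_integral_le_of_norm_le ((hGint k).const_mul (m * h * ∏ i, K i))
          (ae_of_all (ν k) fun x =>
            (show ‖∏ i, ((exp (h * x i) - 1) / h) ^ p i - ∏ i, x i ^ p i‖
                ≤ (m * h * ∏ i, K i) * ∏ i, (exp (c * x i) + exp (-(c * x i))) from by
              rw [Real.norm_eq_abs]; exact hPF_le h hh hle x))
        simpa only [Real.norm_eq_abs] using this
    _ = (m * h * ∏ i, K i) * ∫ x, ∏ i, (exp (c * x i) + exp (-(c * x i))) ∂(ν k) :=
        integral_const_mul _ _
    _ ≤ (m * h * ∏ i, K i) * BG :=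
        mul_le_mul_of_nonneg_left (hBG k) (mul_nonneg (by positivity) hKp)
    _ = h * ((m * ∏ i, K i) * BG) := by ring
    _ ≤ ε := hsmall

end Literature.Probability.Moments
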